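import Literature.MathematicalPhysics.QuantumFieldTheory.Balaban1983to89.Beta.RemainderConstCertified

/-!
# `Balaban1983to89.Beta.RemainderConstUpperDerived` — (U) DERIVED on the constant-remainder roads: on every road of
`Beta.RemainderConstCertified` whose rate binder is TWO-SIDED the printed-type UPPER BOUND `hup : BetaUpperH β' γ₀ β`
(and its companions `hβ' : 0 ≤ β'`, `hlo : −β' ≤ β_{k+1}`) is NOT an independent input — `hup`-free END ∕
Theorem-2-printed sockets, suffix `_cont` (β sub-cell of the audit cell `pub-balaban`, asymptotic lane asym2, journal
node BETA-asym2-g7-U-DERIVED; companion leaf of `Beta.RemainderConstCertified` ("RCC", same writer), split off because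
RCC is at the gate's file-size cap; asym2's side of row an4's `Beta.DriftRemainder` v1.1 §6)

HONEST FRAMING (cell rule, verbatim, page 1 of everything the β sub-cell writes): discharging `BetaPertH` makes
Bałaban's UV stability UNCONDITIONAL — a real constructive-QFT result; it is NOT the continuum limit and NOT the Clay
problem.  THIS MODULE DISCHARGES NOTHING of the series: it is `[folklore]` algebra of inequalities joining, BY NAME,
hypothesis carriers and theorems already in the tree (`Beta.RemainderConstCertified`, `Beta.DriftRemainder`,
`Beta.RateCertificate`, `Beta.Assembly`, `Beta.RemainderChain*`, `FlowStepRuns`), none of which is modified.  Every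
analytic, computational and modelling input is a HYPOTHESIS BINDER; nothing printed by Bałaban is asserted.  Value =
kernel-checked bookkeeping (one printed-type binder shown redundant on the certified roads), NOT summit progress.

ABSOLUTE RULE (cell charter, verbatim): "No internally-minted statement may enter as a cited fact.  Every hypothesis is
either kernel-proved in this package or a verbatim quotation of a PUBLISHED theorem with page reference.  The
manuscript(s) under audit are NOT citable for their own disputed steps — they are the thing under adjudication;
programme-internal (2001/route/tribunal) claims are never citable."  The `[cite: …]` tags below are CONTEXT ONLY (they
say which printed display a hypothesis shape or a conclusion types); no tag imports a fact.

CITATION HEADER (lean-in-tree rule 2026-08-18).  T. Bałaban, *Renormalization group approach to lattice gauge field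
theories. I. Generation of effective actions in a small field approximation and a coupling constant renormalization in
four dimensions*, Commun. Math. Phys. **109**, 249–301 (1987) [Balaban1987RG1] (cell paper B12, [I]): p. 259 Theorem 2
with (0.31) (typed `B12.Thm2Printed`; its constants `β`, `β′` are EXISTENTIALLY quantified — the fact this file turns
on); p. 264 (1.22) and §1 p. 263–264 ("uniformly bounded": the shape `FlowStep.BetaUpperH`; smoothness in the
couplings: `FlowStep.BetaContH`); p. 268 (2.12)–(2.14) (the one-loop split, typed `B12Beta.OneLoopSplit`); p. 293
(5.10), p. 297 (5.42).  T. Bałaban, *Renormalization group approach to lattice gauge field theories. II. Cluster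
expansions*, Commun. Math. Phys. **116**, 1–22 (1988) [Balaban1988RG2Cluster] (cell paper B13, [II]): p. 20 Lemma 3
(2.38); p. 21 ("ε₁ sufficiently small").  T. Bałaban, *Large field renormalization. II. Localization, exponentiation,
and bounds for the 𝐑 operation*, Commun. Math. Phys. **122**, 355–392 (1989) [Balaban1989LargeFieldII] (cell paper
B16, [III]): p. 355 (the interval hypothesis of the «unconditional» reading).  NO convergence statement for the
coefficients (1.22), NO lower bound `β ≥ b > 0` and NO finite-k value is printed in the series (cell records
HOME/BETA-SPEC.md §0.3, HOME/BETA/WALL.md §4): these stay the located OPEN inputs and enter below only as binders.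

## Content ([folklore] throughout)

0. The mechanism and the binder-census consequence (section docstring below).
1. Sequence level: `ceiling_of_geomRate` (`b_k ≤ b_∞ + c₀`), `abs_le_of_geomRate` (`|b_k| ≤ |b_∞| + c₀`),
   `exists_abs_le_of_evGeomRate` (eventual rate ⟹ `∃ G, ∀ k, |b_k| ≤ G`, no certified upper value).
2. β-level: `betaUpperH_of_ceiling_const` (dual of RCC §2's `betaLowerH_of_floor_const`), `betaUpperH_of_band_const`,
   `betaNegLower_of_band_const`, `betaUpperH_of_geomRate_const` (`BetaUpperH (β⁰_∞ + c₀ + r) γ₀ β`).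
3. RCC's floor road with a CEILING in place of `hup`: `thm2Printed_of_floor_ceiling_const`,
   `endpointExistence_of_floor_ceiling_const` (the bare floor road keeps `hup`).
4.–9. The `hup`-free twins, binders = those of the RCC theorem minus `hup` (`hβ'`, `hlo`), same order:
   `endpointExistence_of_certifiedConst_cont`, `thm2Printed_of_certifiedConst_cont`,
   `thm2Printed_of_cauchyCertifiedConst_cont`, `thm2Printed_of_certifiedChainL_cont` (the HEADLINE census theorem without
   (U)), `endpointExistence_of_certifiedChainL_cont`; `endpointExistence_of_marginConst_cont`,
   `thm2Printed_of_marginConst_cont`, `thm2Printed_of_cauchyMarginConst_cont`, `thm2_fineLattices_of_marginConst_cont`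
   (upper constant `β⁰_∞ + c₀ + r` on the fine lattices), `thm2Printed_of_marginChainL_cont`,
   `endpointExistence_of_marginChainL_cont`; `thm2Printed_of_blockMarginConst_cont`,
   `endpointExistence_of_blockMarginConst_cont`; `endpointExistence_of_nearMarginConst_cont`,
   `thm2Printed_of_nearMarginConst_cont`, `thm2Printed_of_depthMarginConst_cont`,
   `thm2Printed_of_blockNearMarginConst_cont`, `endpointExistence_of_blockNearMarginConst_cont`,
   `thm2Printed_of_nearMarginChainL_cont`; `endpointExistence_of_cumNearConst_cont`,
   `p355Unconditional_of_cumNearConst_cont` (the `World`'s `βup` met by a certifiable side condition from ONE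
   certified upper value), `endpointExistence_of_blockCumNearConst_cont`, `endpointExistence_of_lTransferConst_cont`,
   `endpointExistence_of_cumNearChainL_cont`, `thm2Printed_of_cumNearMarginConst_cont`;
   `endpointExistence_of_evMarginConst_cont`, `thm2Printed_of_evMarginConst_cont`,
   `thm2Printed_of_evCauchyMarginConst_cont`, `thm2Printed_of_evMarginChainL_cont`,
   `endpointExistence_of_evMarginChainL_cont`.
10. Kernel checks: the upper bounds ASSUMED by RCC's v1.1 ∕ v1.3 witnesses are the derived ones
   (`Witness.betaUpperH_geomFamily_derived`).
11. (v1.1) The six remaining two-sided-road twins, named by the independent read of v1 (cell record GAPS C-pv09g9-5,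
   INFO I2): `thm2_fineLattices_of_certifiedConst_cont` (band constant `|β⁰_∞| + c₀ + r`),
   `thm2Printed_of_certified_const_cont`, `thm2Printed_of_blockMarginChainL_cont`,
   `thm2_fineLattices_of_nearMarginConst_cont` (upper constant `β⁰_∞ + (c₀ + e) + r`),
   `thm2Printed_of_blockMarginConst'_cont`, `thm2Printed_of_blockNearMarginChainL_cont`; and the exact inventory of the
   RCC declarations carrying `hup` that are NOT twinned, with the reason for each (section docstring).

STILL OPEN for an unconditional Theorem 2 (precisely, unchanged by this file): the rate (asym1, O-asym1-1; on the
near ∕ cumulative roads the rate of the comparison sequence plus the transfer binder), the certificates (cap; none in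
the tree for Bałaban's split), the chain leaves (D4), joint continuity (C) (D5).  (U) was a printed-type binder, never
a wall row: NO open item closes here and none opens.

VERSIONS.  v1: asym2 generation 7 (p186995); RCC v1.5 carries the pointer (its Content item 12).  v1.1 (this file):
asym2 generation 8, APPEND-ONLY — every declaration of §§1–10 byte-identical; + §11 (six theorems, [folklore] one-term
compositions) answering the independent read GAPS C-pv09g9-5 INFO I2 (v1's §0 coverage sentence was true as mathematics
and inexact as an inventory); besides §11 only this sentence, Content item 11 and one sentence of §0 change.
-/

namespace Literature.MathematicalPhysics.QuantumFieldTheory.Balaban1983to89.Beta.RemainderConstUpperDerived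

open Literature.MathematicalPhysics.QuantumFieldTheory.Balaban1983to89
open FlowStep DagBinding FlowStepRuns
open Literature.MathematicalPhysics.QuantumFieldTheory.Balaban1983to89.Beta.Assembly
open Literature.MathematicalPhysics.QuantumFieldTheory.Balaban1983to89.Beta.RemainderChain
open Literature.MathematicalPhysics.QuantumFieldTheory.Balaban1983to89.Beta.RemainderChainLattice
open Literature.MathematicalPhysics.QuantumFieldTheory.Balaban1983to89.Beta.RemainderChainTorus
open Literature.MathematicalPhysics.QuantumFieldTheory.Balaban1983to89.Beta.RateCertificate
open Literature.MathematicalPhysics.QuantumFieldTheory.Balaban1983to89.Beta.RemainderConstCertified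

variable {β : HBeta} {d : ℕ}

/-! ## 0. The mechanism (§-numbers = the sections of `Beta.RemainderConstCertified`, "RCC")

Row an4's `Beta.DriftRemainder` v1.1 §6 observes, on the drift road, that the END binder `hup : BetaUpperH β' γ₀ β` (and
its sign `0 ≤ β'`) is DERIVABLE: a drift controls every single one-loop coefficient and `RemainderConst S γ₀ r` is
two-sided by definition (`DriftRemainder.betaUpperH_of_drift_remainderConst`,
`DriftRemainder.endpointExistence_of_drift_remainderConst_cont`,
`DriftRemainder.p355Unconditional_of_drift_remainderConst_cont`).
The same holds on EVERY road of RCC whose rate binder is two-sided — which is all of them except the bare floor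
road of §3 ∕ §11 (`thm2Printed_of_floor_const`, `endpointExistence_of_floor_const`: a one-sided floor `f ≤ β⁰_{k+1}` does
not bound `β⁰` above, and there `hup` STAYS; a floor-AND-ceiling socket is offered instead):
* `GeomRate S.β0 binf c₀ θ` with `0 ≤ θ ≤ 1` gives the CEILING `β⁰_{k+1} ≤ β⁰_∞ + c₀` and the band
  `|β⁰_{k+1}| ≤ |β⁰_∞| + c₀` for every `k` (`ceiling_of_geomRate`, `abs_le_of_geomRate`) — §4, §5, §7, §8 (block road: the
  rate of `S.β0` is `(cauchyRate_of_block …).geomRate`), §9 (near road: `NearRate.geomRate`, constant `c₀ + e`), §10 at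
  Theorem-2 grade (`CumNear.abs_sub_le`: `+ 2Γ`);
* `EvGeomRate S.β0 binf c₀ θ k₁` gives a ceiling on the tail `k ≥ k₁`, and the finitely many values below the threshold
  bound themselves — `∃ G, ∀ k, |β⁰_{k+1}| ≤ G` (`exists_abs_le_of_evGeomRate`) — §11; NO certified upper value is needed,
  because the END statements quantify the upper constant existentially;
* on §10's END-grade roads (drift transport) an4's `_cont` sockets are used BY NAME.
With the constant remainder, `β_{k+1} = β⁰_{k+1} + β¹_{k+1} ≤ g + r` on every `]0,γ₀]`-box (`betaUpperH_of_ceiling_const`,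
the dual of §2's `betaLowerH_of_floor_const`; band form `betaUpperH_of_band_const` ∕ `betaNegLower_of_band_const` for
the lower companion `−β' ≤ β_{k+1}` of `Assembly.EventualForm`).  Since `B12.Thm2Printed C L` quantifies its constants
`∃ β β'` ((0.31): the upper constant `β'/log L` is ANY admissible one) and `DagBinding.EndpointExistence C` names no
upper constant at all, every END ∕ Theorem-2-printed theorem of §§4–11 has a twin WITHOUT `hup` (and without `hβ'`,
`hlo` where present), suffix `_cont` as in an4's §6: of the wall's row (D5) «(C) + printed-type upper bound» only joint
continuity `hcont : BetaContH γ₀ β` remains a hypothesis by name; all other binders are those of the v1–v1.4 theorem,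
in the same order.  The p. 355 reading keeps the `World`'s bookkeeping constant `w.βup`; it is met by a CERTIFIABLE
numeric side condition from ONE certified UPPER value `a_{k₁+1} ≤ M_c` of the comparison sequence
(`GeomRate.binf_le`): `p355Unconditional_of_cumNearConst_cont`.

BINDER CENSUS CONSEQUENCE (RULING (R15) form; RCC's header census of `thm2Printed_of_certifiedChainL`): on every
certified road the line `hup : BetaUpperH β' γ₀ β — (U)` LEAVES the census (`thm2Printed_of_certifiedChainL_cont`,
`endpointExistence_of_certifiedChainL_cont` and the `_cont` twins below).  (U) was a printed-type binder ([I] p. 264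
«uniformly bounded», (5.10), (5.42)), never a wall row, so NO open item closes and none opens: STILL OPEN, unchanged,
are the rate (asym1, O-asym1-1; on the §9 ∕ §10 roads the rate of the comparison sequence plus the transfer binder —
(D1) twice per RULING (R19-1), resp. Q-asym1-5), the certificates (cap; none in the tree for Bałaban's split), the
chain leaves (D4) and (C) (D5).  The twins are spelled out in §§4–9 and (v1.1) §11; the symbol ∕ strip ∕ real-zone ∕
torus-chain ∕ elementary-coefficient ∕ smallK variants of RCC §§4, 5, 7, 8 (one-term specialisations of twinned theorems)
and the `def` carriers `eventualFormOfCertifiedConst(_consts)` ∕ `eventualFormOfMarginConst(_consts)` (instantiate `β'`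
with the derived constant) obtain their `_cont` forms by the same one-term substitution and are not spelled out — the
exact inventory, declaration by declaration, is §11's docstring.  [folklore] algebra joining landed theorems by name;
nothing of the series is discharged; NOT Theorem 2 ∕ endpoint existence unconditionally, NOT the continuum limit, NOT
the Clay problem. -/

/-! ## 1. Sequence level: ceilings and bands from a two-sided rate -/

/-- **Ceiling from a two-sided rate**: `GeomRate b binf c₀ θ` with `0 ≤ θ ≤ 1` gives `b k ≤ b_∞ + c₀` for every `k`
(`|b k − b_∞| ≤ c₀θ^k ≤ c₀`; `b_∞` any real, never identified). [folklore] -/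
theorem ceiling_of_geomRate {b : ℕ → ℝ} {binf c₀ θ : ℝ} (h : GeomRate b binf c₀ θ) (hθ0 : 0 ≤ θ) (hθ1 : θ ≤ 1) :
    ∀ k, b k ≤ binf + c₀ := fun k => by
  have h1 := (abs_le.mp (h k)).2
  have h2 : c₀ * θ ^ k ≤ c₀ := by
    simpa using mul_le_mul_of_nonneg_left (pow_le_one₀ hθ0 hθ1 : θ ^ k ≤ 1) h.const_nonneg
  linarith

/-- **Band from a two-sided rate**: `|b k| ≤ |b_∞| + c₀` for every `k`. [folklore] -/
theorem abs_le_of_geomRate {b : ℕ → ℝ} {binf c₀ θ : ℝ} (h : GeomRate b binf c₀ θ) (hθ0 : 0 ≤ θ) (hθ1 : θ ≤ 1) :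
    ∀ k, |b k| ≤ |binf| + c₀ := fun k => by
  have h1 := h k
  have h2 : c₀ * θ ^ k ≤ c₀ := by
    simpa using mul_le_mul_of_nonneg_left (pow_le_one₀ hθ0 hθ1 : θ ^ k ≤ 1) h.const_nonneg
  calc |b k| = |(b k - binf) + binf| := by rw [sub_add_cancel]
    _ ≤ |b k - binf| + |binf| := abs_add_le _ _
    _ ≤ |binf| + c₀ := by linarith

/-- **Band from an EVENTUAL rate — no certified upper value needed**: `EvGeomRate b binf c₀ θ k₁` (`0 ≤ θ ≤ 1`) bounds
the tail by `|b_∞| + c₀θ^{k₁}` (`EvGeomRate.shift`) and the finitely many values below the threshold bound themselves: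
`∃ G, ∀ k, |b k| ≤ G` (witness `G = |b_∞| + c₀θ^{k₁} + Σ_{j<k₁} |b j|`). [folklore] -/
theorem exists_abs_le_of_evGeomRate {b : ℕ → ℝ} {binf c₀ θ : ℝ} {k₁ : ℕ} (h : EvGeomRate b binf c₀ θ k₁)
    (hθ0 : 0 ≤ θ) (hθ1 : θ ≤ 1) : ∃ G : ℝ, ∀ k, |b k| ≤ G := by
  refine ⟨|binf| + c₀ * θ ^ k₁ + ∑ j ∈ Finset.range k₁, |b j|, fun k => ?_⟩
  have hs : 0 ≤ ∑ j ∈ Finset.range k₁, |b j| := Finset.sum_nonneg fun j _ => abs_nonneg _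
  have hq : 0 ≤ c₀ * θ ^ k₁ := h.slack_nonneg
  rcases lt_or_ge k k₁ with hk | hk
  · have h1 : |b k| ≤ ∑ j ∈ Finset.range k₁, |b j| :=
      Finset.single_le_sum (f := fun j => |b j|) (fun j _ => abs_nonneg _) (Finset.mem_range.mpr hk)
    linarith [abs_nonneg binf]
  · obtain ⟨j, rfl⟩ := Nat.exists_eq_add_of_le hk
    have h1 : |b (j + k₁)| ≤ |binf| + c₀ * θ ^ k₁ := abs_le_of_geomRate h.shift hθ0 hθ1 j
    rw [Nat.add_comm k₁ j]
    linarith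

/-! ## 2. β-level: the printed-type upper bound from a ceiling ∕ band and the constant form -/

/-- **`β_{k+1} ≤ g + r` on ALL boxes from a uniform CEILING and the constant form** — the dual of §2's
`betaLowerH_of_floor_const`: `β⁰_{k+1} ≤ g` for all `k` and `|β¹_{k+1}(p)| ≤ r` on `]0,γ₀]^{k+1}` give
`FlowStep.BetaUpperH (g + r) γ₀ β` through the printed split. [cite: Balaban1987RG1, (2.12)–(2.14) p.268] -/
theorem betaUpperH_of_ceiling_const (S : B12Beta.OneLoopSplit β) {γ₀ g r : ℝ} (hG : ∀ k, S.β0 k ≤ g)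
    (hrem : RemainderConst S γ₀ r) : BetaUpperH (g + r) γ₀ β := fun k v hv => by
  have h1 := (abs_le.mp (hrem k v (histBox_of_mem_box hv))).2
  rw [S.split k v]
  linarith [hG k]

/-- Band form: `|β⁰_{k+1}| ≤ g` for all `k` and the constant form give the printed-type TWO-SIDED bound with ONE
constant `β' = g + r` — here `β_{k+1} ≤ β'` … [folklore] -/
theorem betaUpperH_of_band_const (S : B12Beta.OneLoopSplit β) {γ₀ g r : ℝ} (hB : ∀ k, |S.β0 k| ≤ g)
    (hrem : RemainderConst S γ₀ r) : BetaUpperH (g + r) γ₀ β :=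
  betaUpperH_of_ceiling_const S (fun k => (le_abs_self _).trans (hB k)) hrem

/-- … and `−β' ≤ β_{k+1}` on every `]0,γ₀]`-box (the field `lower` of `Assembly.EventualForm`). [folklore] -/
theorem betaNegLower_of_band_const (S : B12Beta.OneLoopSplit β) {γ₀ g r : ℝ} (hB : ∀ k, |S.β0 k| ≤ g)
    (hrem : RemainderConst S γ₀ r) : ∀ k, ∀ v ∈ Box γ₀ k, -(g + r) ≤ β k v := fun k v hv => by
  have h1 := (abs_le.mp (hrem k v (histBox_of_mem_box hv))).1
  have h2 := (abs_le.mp (hB k)).1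
  rw [S.split k v]
  linarith

/-- **(U) DERIVED on the certified road**: `GeomRate S.β0 binf c₀ θ` (`0 ≤ θ ≤ 1`; `binf` ANY real, never identified
with a printed value) and `RemainderConst S γ₀ r` give `FlowStep.BetaUpperH (binf + c₀ + r) γ₀ β` — the binder `hup` of
§§3–11 is not an independent input on any two-sided road. [cite: Balaban1987RG1, (1.22) p.264 and (2.12)–(2.14) p.268] -/
theorem betaUpperH_of_geomRate_const (S : B12Beta.OneLoopSplit β) {γ₀ binf c₀ θ r : ℝ} (hθ0 : 0 ≤ θ) (hθ1 : θ ≤ 1)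
    (hconv : GeomRate S.β0 binf c₀ θ) (hrem : RemainderConst S γ₀ r) : BetaUpperH (binf + c₀ + r) γ₀ β :=
  betaUpperH_of_ceiling_const S (ceiling_of_geomRate hconv hθ0 hθ1) hrem

/-! ## 3. The floor road (§3 ∕ §11) with a CEILING in place of `hup` -/

/-- **THEOREM 2 AS PRINTED from a uniform FLOOR, a uniform CEILING and the constant form** — §3's
`thm2Printed_of_floor_const` with (U) DERIVED (`β' = g + r`): `f ≤ β⁰_{k+1} ≤ g` (all `k`), `RemainderConst S γ₀ r`,
`r < f`, (C), under the DAG.  On the bare floor road (no ceiling) `hup` stays. [cite: Balaban1987RG1, Thm 2 p.259 with (0.31)] -/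
theorem thm2Printed_of_floor_ceiling_const {C : B12.Construction} (hgen : ForwardGenerated C β) {L : ℝ} (hL : 1 < L)
    (S : B12Beta.OneLoopSplit β) {γ₀ f g r : ℝ} (hγ₀ : 0 < γ₀) (hF : ∀ k, f ≤ S.β0 k) (hG : ∀ k, S.β0 k ≤ g)
    (hrem : RemainderConst S γ₀ r) (hr : r < f) (hcont : BetaContH γ₀ β) : B12.Thm2Printed C L :=
  thm2Printed_of_floor_const hgen hL S hγ₀ hF hrem hr hcont (betaUpperH_of_ceiling_const S hG hrem)

/-- **The END socket of the floor road with a ceiling**: floor + ceiling + constant form + `r < f` + (C) ⟹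
`EndpointExistence C` (§11's `endpointExistence_of_floor_const` at `β' = g + r`). [cite: Balaban1987RG1, Thm 2 p.259 (first sentence)] -/
theorem endpointExistence_of_floor_ceiling_const {C : B12.Construction} (hgen : ForwardGenerated C β)
    (S : B12Beta.OneLoopSplit β) {γ₀ f g r : ℝ} (hγ₀ : 0 < γ₀) (hF : ∀ k, f ≤ S.β0 k) (hG : ∀ k, S.β0 k ≤ g)
    (hrem : RemainderConst S γ₀ r) (hr : r < f) (hcont : BetaContH γ₀ β) : EndpointExistence C :=
  endpointExistence_of_floor_const hgen S hγ₀ hF hrem hr (betaUpperH_of_ceiling_const S hG hrem) hcont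

/-! ## 4. The certified road (§4) and its chain level (§5) without `hup`, `hlo` -/

/-- **The END statement on the certified road, (U) DERIVED** — §4's `endpointExistence_of_certifiedConst` with the
two-sided bound `|β_{k+1}| ≤ |β⁰_∞| + c₀ + r` DERIVED from `hconv` and `hrem` (binders `hup`, `hlo` gone; all others as
in v1, same order). [cite: Balaban1987RG1, Thm 2 p.259 (first sentence)] -/
theorem endpointExistence_of_certifiedConst_cont {C : B12.Construction} (hgen : ForwardGenerated C β)
    (S : B12Beta.OneLoopSplit β) {γ₀ binf c₀ θ r m : ℝ} {k₁ k₂ : ℕ} (hγ₀ : 0 < γ₀) (hθ0 : 0 ≤ θ) (hθ1 : θ ≤ 1)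
    (hconv : GeomRate S.β0 binf c₀ θ) (hcert : m ≤ S.β0 k₁) (hk₂ : c₀ * θ ^ k₂ ≤ (m - c₀ * θ ^ k₁) / 4)
    (hrem : RemainderConst S γ₀ r) (hr : r < 3 * (m - c₀ * θ ^ k₁) / 4) (hcont : BetaContH γ₀ β) :
    EndpointExistence C :=
  endpointExistence_of_certifiedConst hgen S hγ₀ hθ0 hθ1 hconv hcert hk₂ hrem hr
    (betaUpperH_of_band_const S (abs_le_of_geomRate hconv hθ0 hθ1) hrem)
    (betaNegLower_of_band_const S (abs_le_of_geomRate hconv hθ0 hθ1) hrem) hcont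

/-- **THEOREM 2 AS PRINTED on the certified road, (U) DERIVED** — §4's `thm2Printed_of_certifiedConst` without `hup`
(upper constant `β⁰_∞ + c₀ + r`). [cite: Balaban1987RG1, Thm 2 p.259 with (0.31)] -/
theorem thm2Printed_of_certifiedConst_cont {C : B12.Construction} (hgen : ForwardGenerated C β) {L : ℝ} (hL : 1 < L)
    (S : B12Beta.OneLoopSplit β) {γ₀ binf c₀ θ r m m₀ : ℝ} {k₁ k₂ : ℕ} (hγ₀ : 0 < γ₀) (hθ0 : 0 ≤ θ) (hθ1 : θ ≤ 1)
    (hconv : GeomRate S.β0 binf c₀ θ) (hcert : m ≤ S.β0 k₁) (hk₂ : c₀ * θ ^ k₂ ≤ (m - c₀ * θ ^ k₁) / 4)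
    (hsmall : ∀ k, k < k₂ → m₀ ≤ S.β0 k) (hrem : RemainderConst S γ₀ r)
    (hr : r < min m₀ (3 * (m - c₀ * θ ^ k₁) / 4)) (hcont : BetaContH γ₀ β) : B12.Thm2Printed C L :=
  thm2Printed_of_certifiedConst hgen hL S hγ₀ hθ0 hθ1 hconv hcert hk₂ hsmall hrem hr hcont
    (betaUpperH_of_geomRate_const S hθ0 hθ1 hconv hrem)

/-- Cauchy form of the preceding (`hθ1 : θ < 1`, `RateCertificate.CauchyRate.geomRate`), without `hup`.
[cite: Balaban1987RG1, Thm 2 p.259 with (0.31)] -/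
theorem thm2Printed_of_cauchyCertifiedConst_cont {C : B12.Construction} (hgen : ForwardGenerated C β) {L : ℝ}
    (hL : 1 < L) (S : B12Beta.OneLoopSplit β) {γ₀ c θ r m m₀ : ℝ} {k₁ k₂ : ℕ} (hγ₀ : 0 < γ₀) (hθ0 : 0 ≤ θ)
    (hθ1 : θ < 1) (hrate : CauchyRate S.β0 c θ) (hcert : m ≤ S.β0 k₁)
    (hk₂ : c / (1 - θ) * θ ^ k₂ ≤ (m - c / (1 - θ) * θ ^ k₁) / 4) (hsmall : ∀ k, k < k₂ → m₀ ≤ S.β0 k)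
    (hrem : RemainderConst S γ₀ r) (hr : r < min m₀ (3 * (m - c / (1 - θ) * θ ^ k₁) / 4))
    (hcont : BetaContH γ₀ β) : B12.Thm2Printed C L :=
  thm2Printed_of_certifiedConst_cont hgen hL S hγ₀ hθ0 hθ1.le (hrate.geomRate hθ1) hcert hk₂ hsmall hrem hr hcont

/-- **THEOREM 2 AS PRINTED FROM THE THREE LANES, window chain, (U) DERIVED** — the headline `thm2Printed_of_certifiedChainL`
WITHOUT the binder `hup`: DAG, two-sided rate with `0 ≤ θ ≤ 1`, the two certificates, the chain leaves under `CondsL`,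
the closing relation, the signs, the restriction `ε₁·K_rem,L < min m₀ (3(m − c₀θ^{k₁})/4)`, and (C) — nothing else.
The binder census of the header minus the line (U).  NOT Theorem 2 unconditionally. [cite: Balaban1987RG1, Thm 2 p.259 with (0.31); Balaban1988RG2Cluster, (2.38) p.20 and p.21] -/
theorem thm2Printed_of_certifiedChainL_cont {C : B12.Construction} (hgen : ForwardGenerated C β) {L : ℝ} (hL : 1 < L)
    (S : B12Beta.OneLoopSplit β) {M : ℕ} {μ ν : Fin d} {γ₀ : ℝ} {c : B13.Consts} {ℓ α₂ B₃ : ℝ}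
    (R : ChainL d M μ ν S γ₀ c ℓ α₂ B₃) (hC : CondsL d c ℓ) (h22 : c.R22gen ℓ) (hs : SignsL c α₂ B₃) (hd : 0 < d)
    (hM : 0 < M) {binf c₀ θ m m₀ : ℝ} {k₁ k₂ : ℕ} (hγ₀ : 0 < γ₀) (hθ0 : 0 ≤ θ) (hθ1 : θ ≤ 1)
    (hconv : GeomRate S.β0 binf c₀ θ) (hcert : m ≤ S.β0 k₁) (hk₂ : c₀ * θ ^ k₂ ≤ (m - c₀ * θ ^ k₁) / 4)
    (hsmall : ∀ k, k < k₂ → m₀ ≤ S.β0 k)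
    (hε₁ : c.ε₁ * remCoeffL d M c α₂ B₃ < min m₀ (3 * (m - c₀ * θ ^ k₁) / 4)) (hcont : BetaContH γ₀ β) :
    B12.Thm2Printed C L :=
  thm2Printed_of_certifiedConst_cont hgen hL S hγ₀ hθ0 hθ1 hconv hcert hk₂ hsmall (R.abs_beta1_le hC h22 hs hd hM) hε₁
    hcont

/-- **The END statement from the three lanes, window chain, (U) DERIVED** — `endpointExistence_of_certifiedChainL`
without `hup`, `hlo`. [cite: Balaban1987RG1, Thm 2 p.259 (first sentence); Balaban1988RG2Cluster, (2.38) p.20 and p.21] -/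
theorem endpointExistence_of_certifiedChainL_cont {C : B12.Construction} (hgen : ForwardGenerated C β)
    (S : B12Beta.OneLoopSplit β) {M : ℕ} {μ ν : Fin d} {γ₀ : ℝ} {c : B13.Consts} {ℓ α₂ B₃ : ℝ}
    (R : ChainL d M μ ν S γ₀ c ℓ α₂ B₃) (hC : CondsL d c ℓ) (h22 : c.R22gen ℓ) (hs : SignsL c α₂ B₃) (hd : 0 < d)
    (hM : 0 < M) {binf c₀ θ m : ℝ} {k₁ k₂ : ℕ} (hγ₀ : 0 < γ₀) (hθ0 : 0 ≤ θ) (hθ1 : θ ≤ 1)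
    (hconv : GeomRate S.β0 binf c₀ θ) (hcert : m ≤ S.β0 k₁) (hk₂ : c₀ * θ ^ k₂ ≤ (m - c₀ * θ ^ k₁) / 4)
    (hε₁ : c.ε₁ * remCoeffL d M c α₂ B₃ < 3 * (m - c₀ * θ ^ k₁) / 4) (hcont : BetaContH γ₀ β) :
    EndpointExistence C :=
  endpointExistence_of_certifiedConst_cont hgen S hγ₀ hθ0 hθ1 hconv hcert hk₂ (R.abs_beta1_le hC h22 hs hd hM) hε₁
    hcont

/-! ## 5. The one-sided certified-list road (§7) and its chain level without `hup` -/

/-- **END on the margin road, (U) DERIVED** — §7's `endpointExistence_of_marginConst` without `hup` (upper constant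
`β⁰_∞ + c₀ + r`). [cite: Balaban1987RG1, Thm 2 p.259 (first sentence)] -/
theorem endpointExistence_of_marginConst_cont {C : B12.Construction} (hgen : ForwardGenerated C β)
    (S : B12Beta.OneLoopSplit β) {γ₀ binf c₀ θ r m : ℝ} {k₁ : ℕ} (hγ₀ : 0 < γ₀) (hθ0 : 0 ≤ θ) (hθ1 : θ ≤ 1)
    (hconv : GeomRate S.β0 binf c₀ θ) (hlist : ∀ k, k ≤ k₁ → m ≤ S.β0 k) (hrem : RemainderConst S γ₀ r)
    (hr : r < m - c₀ * θ ^ k₁ * (1 + θ)) (hcont : BetaContH γ₀ β) : EndpointExistence C :=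
  endpointExistence_of_marginConst hgen S hγ₀ hθ0 hθ1 hconv hlist hrem hr
    (betaUpperH_of_geomRate_const S hθ0 hθ1 hconv hrem) hcont

/-- **THEOREM 2 AS PRINTED on the margin road, (U) DERIVED** — §7's `thm2Printed_of_marginConst` without `hup`.
[cite: Balaban1987RG1, Thm 2 p.259 with (0.31)] -/
theorem thm2Printed_of_marginConst_cont {C : B12.Construction} (hgen : ForwardGenerated C β) {L : ℝ} (hL : 1 < L)
    (S : B12Beta.OneLoopSplit β) {γ₀ binf c₀ θ r m : ℝ} {k₁ : ℕ} (hγ₀ : 0 < γ₀) (hθ0 : 0 ≤ θ) (hθ1 : θ ≤ 1)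
    (hconv : GeomRate S.β0 binf c₀ θ) (hlist : ∀ k, k ≤ k₁ → m ≤ S.β0 k) (hrem : RemainderConst S γ₀ r)
    (hr : r < m - c₀ * θ ^ k₁ * (1 + θ)) (hcont : BetaContH γ₀ β) : B12.Thm2Printed C L :=
  thm2Printed_of_marginConst hgen hL S hγ₀ hθ0 hθ1 hconv hlist hrem hr hcont
    (betaUpperH_of_geomRate_const S hθ0 hθ1 hconv hrem)

/-- Cauchy form of the preceding (`hθ1 : θ < 1`), without `hup`. [cite: Balaban1987RG1, Thm 2 p.259 with (0.31)] -/
theorem thm2Printed_of_cauchyMarginConst_cont {C : B12.Construction} (hgen : ForwardGenerated C β) {L : ℝ}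
    (hL : 1 < L) (S : B12Beta.OneLoopSplit β) {γ₀ c θ r m : ℝ} {k₁ : ℕ} (hγ₀ : 0 < γ₀) (hθ0 : 0 ≤ θ)
    (hθ1 : θ < 1) (hrate : CauchyRate S.β0 c θ) (hlist : ∀ k, k ≤ k₁ → m ≤ S.β0 k) (hrem : RemainderConst S γ₀ r)
    (hr : r < m - c / (1 - θ) * θ ^ k₁ * (1 + θ)) (hcont : BetaContH γ₀ β) : B12.Thm2Printed C L :=
  thm2Printed_of_marginConst_cont hgen hL S hγ₀ hθ0 hθ1.le (hrate.geomRate hθ1) hlist hrem hr hcont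

/-- **(0.31) WITH the upper constant on the fine lattices, (U) DERIVED** — §7's `thm2_fineLattices_of_marginConst`
without `hup`: the realised coupling sequence satisfies `Step.Discrete031 b β' K g` with the floor road's lower constant
`b = (m − c₀θ^{k₁}(1 + θ) − r)/2` and the DERIVED upper constant `β' = β⁰_∞ + c₀ + r`.
[cite: Balaban1987RG1, Thm 2 p.259 with (0.31)] -/
theorem thm2_fineLattices_of_marginConst_cont {C : B12.Construction} (hgen : ForwardGenerated C β)
    (S : B12Beta.OneLoopSplit β) {γ₀ binf c₀ θ r m : ℝ} {k₁ : ℕ} (hγ₀ : 0 < γ₀) (hθ0 : 0 ≤ θ) (hθ1 : θ ≤ 1)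
    (hconv : GeomRate S.β0 binf c₀ θ) (hlist : ∀ k, k ≤ k₁ → m ≤ S.β0 k) (hrem : RemainderConst S γ₀ r)
    (hr : r < m - c₀ * θ ^ k₁ * (1 + θ)) (hcont : BetaContH γ₀ β) :
    ∀ (n : ℕ) (γ : ℝ), 0 < γ → γ ≤ γ₀ → ∀ g : ℝ, 0 < g → g ≤ γ → ∀ K : ℕ,
      ∃ g0 : ℝ, (C ⟨K, n, g0⟩).flow.InInterval γ K ∧ (C ⟨K, n, g0⟩).flow.g K = g ∧
        Step.Discrete031 ((m - c₀ * θ ^ k₁ * (1 + θ) - r) / 2) (binf + c₀ + r) K g (C ⟨K, n, g0⟩).flow.g :=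
  thm2_fineLattices_of_marginConst hgen S hγ₀ hθ0 hθ1 hconv hlist hrem hr
    (betaUpperH_of_geomRate_const S hθ0 hθ1 hconv hrem) hcont

/-- **Theorem 2 as printed from the three lanes on the margin road, window chain, (U) DERIVED** —
`thm2Printed_of_marginChainL` without `hup`. [cite: Balaban1987RG1, Thm 2 p.259 with (0.31); Balaban1988RG2Cluster, (2.38) p.20 and p.21] -/
theorem thm2Printed_of_marginChainL_cont {C : B12.Construction} (hgen : ForwardGenerated C β) {L : ℝ} (hL : 1 < L)
    (S : B12Beta.OneLoopSplit β) {M : ℕ} {μ ν : Fin d} {γ₀ : ℝ} {c : B13.Consts} {ℓ α₂ B₃ : ℝ}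
    (R : ChainL d M μ ν S γ₀ c ℓ α₂ B₃) (hC : CondsL d c ℓ) (h22 : c.R22gen ℓ) (hs : SignsL c α₂ B₃) (hd : 0 < d)
    (hM : 0 < M) {binf c₀ θ m : ℝ} {k₁ : ℕ} (hγ₀ : 0 < γ₀) (hθ0 : 0 ≤ θ) (hθ1 : θ ≤ 1)
    (hconv : GeomRate S.β0 binf c₀ θ) (hlist : ∀ k, k ≤ k₁ → m ≤ S.β0 k)
    (hε₁ : c.ε₁ * remCoeffL d M c α₂ B₃ < m - c₀ * θ ^ k₁ * (1 + θ)) (hcont : BetaContH γ₀ β) :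
    B12.Thm2Printed C L :=
  thm2Printed_of_marginConst_cont hgen hL S hγ₀ hθ0 hθ1 hconv hlist (R.abs_beta1_le hC h22 hs hd hM) hε₁ hcont

/-- **END from the three lanes on the margin road, window chain, (U) DERIVED** — `endpointExistence_of_marginChainL`
without `hup`. [cite: Balaban1987RG1, Thm 2 p.259 (first sentence); Balaban1988RG2Cluster, (2.38) p.20 and p.21] -/
theorem endpointExistence_of_marginChainL_cont {C : B12.Construction} (hgen : ForwardGenerated C β)
    (S : B12Beta.OneLoopSplit β) {M : ℕ} {μ ν : Fin d} {γ₀ : ℝ} {c : B13.Consts} {ℓ α₂ B₃ : ℝ}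
    (R : ChainL d M μ ν S γ₀ c ℓ α₂ B₃) (hC : CondsL d c ℓ) (h22 : c.R22gen ℓ) (hs : SignsL c α₂ B₃) (hd : 0 < d)
    (hM : 0 < M) {binf c₀ θ m : ℝ} {k₁ : ℕ} (hγ₀ : 0 < γ₀) (hθ0 : 0 ≤ θ) (hθ1 : θ ≤ 1)
    (hconv : GeomRate S.β0 binf c₀ θ) (hlist : ∀ k, k ≤ k₁ → m ≤ S.β0 k)
    (hε₁ : c.ε₁ * remCoeffL d M c α₂ B₃ < m - c₀ * θ ^ k₁ * (1 + θ)) (hcont : BetaContH γ₀ β) :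
    EndpointExistence C :=
  endpointExistence_of_marginConst_cont hgen S hγ₀ hθ0 hθ1 hconv hlist (R.abs_beta1_le hC h22 hs hd hM) hε₁ hcont

/-! ## 6. The block-scale road (§8) without `hup` -/

/-- **Theorem 2 as printed AT BLOCK SIZE `L' = Lⁿ` from SMALL-block data, (U) DERIVED** —
`thm2Printed_of_blockMarginConst` without `hup`: the rate of `S.β0 = blockSum n b` is itself two-sided
(`(cauchyRate_of_block …).geomRate`, ratio `θⁿ < 1`). [cite: Balaban1987RG1, Thm 2 p.259 with (0.31)] -/
theorem thm2Printed_of_blockMarginConst_cont {C : B12.Construction} (hgen : ForwardGenerated C β) {L' : ℝ}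
    (hL : 1 < L') (S : B12Beta.OneLoopSplit β) {b : ℕ → ℝ} {n : ℕ} (hn : 0 < n)
    (hblock : ∀ k, S.β0 k = blockSum n b k) {γ₀ a θ r m : ℝ} {k₁ : ℕ} (hγ₀ : 0 < γ₀) (hθ0 : 0 ≤ θ)
    (hθ1 : θ < 1) (hrate : CauchyRate b a θ) (hlist : ∀ k, k ≤ k₁ → m ≤ blockSum n b k)
    (hrem : RemainderConst S γ₀ r)
    (hr : r < m - a * (∑ i ∈ Finset.range n, θ ^ i) ^ 2 / (1 - θ ^ n) * (θ ^ n) ^ k₁ * (1 + θ ^ n))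
    (hcont : BetaContH γ₀ β) : B12.Thm2Printed C L' :=
  thm2Printed_of_cauchyMarginConst_cont hgen hL S hγ₀ (pow_nonneg hθ0 n) (pow_lt_one₀ hθ0 hθ1 hn.ne')
    (cauchyRate_of_block S hblock hrate) (list_of_block S hblock hlist) hrem hr hcont

/-- **END at block size from small-block data, (U) DERIVED** — `endpointExistence_of_blockMarginConst` without
`hup`. [cite: Balaban1987RG1, Thm 2 p.259 (first sentence)] -/
theorem endpointExistence_of_blockMarginConst_cont {C : B12.Construction} (hgen : ForwardGenerated C β)
    (S : B12Beta.OneLoopSplit β) {b : ℕ → ℝ} {n : ℕ} (hn : 0 < n) (hblock : ∀ k, S.β0 k = blockSum n b k)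
    {γ₀ a θ r m : ℝ} {k₁ : ℕ} (hγ₀ : 0 < γ₀) (hθ0 : 0 ≤ θ) (hθ1 : θ < 1) (hrate : CauchyRate b a θ)
    (hlist : ∀ k, k ≤ k₁ → m ≤ blockSum n b k) (hrem : RemainderConst S γ₀ r)
    (hr : r < m - a * (∑ i ∈ Finset.range n, θ ^ i) ^ 2 / (1 - θ ^ n) * (θ ^ n) ^ k₁ * (1 + θ ^ n))
    (hcont : BetaContH γ₀ β) : EndpointExistence C :=
  have hθn1 : θ ^ n < 1 := pow_lt_one₀ hθ0 hθ1 hn.ne'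
  endpointExistence_of_marginConst_cont hgen S hγ₀ (pow_nonneg hθ0 n) hθn1.le
    ((cauchyRate_of_block S hblock hrate).geomRate hθn1) (list_of_block S hblock hlist) hrem hr hcont

/-! ## 7. The near road (§9) without `hup` -/

/-- **END on the near road, (U) DERIVED** — §9's `endpointExistence_of_nearMarginConst` without `hup`: the rate of
`S.β0` is `NearRate.geomRate` (constant `c₀ + e`). [cite: Balaban1987RG1, Thm 2 p.259 (first sentence)] -/
theorem endpointExistence_of_nearMarginConst_cont {C : B12.Construction} (hgen : ForwardGenerated C β)
    (S : B12Beta.OneLoopSplit β) {a : ℕ → ℝ} {γ₀ binf c₀ θ e r m : ℝ} {k₁ : ℕ} (hγ₀ : 0 < γ₀) (hθ0 : 0 ≤ θ)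
    (hθ1 : θ ≤ 1) (hconv : GeomRate a binf c₀ θ) (hnear : NearRate a S.β0 e θ) (hlist : ∀ k, k ≤ k₁ → m ≤ a k)
    (hrem : RemainderConst S γ₀ r) (hr : r < m - e - (c₀ + e) * θ ^ k₁ * (1 + θ)) (hcont : BetaContH γ₀ β) :
    EndpointExistence C :=
  endpointExistence_of_nearMarginConst hgen S hγ₀ hθ0 hθ1 hconv hnear hlist hrem hr
    (betaUpperH_of_geomRate_const S hθ0 hθ1 (hnear.geomRate hconv) hrem) hcont

/-- **Theorem 2 as printed on the near road, (U) DERIVED** — §9's `thm2Printed_of_nearMarginConst` without `hup`.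
[cite: Balaban1987RG1, Thm 2 p.259 with (0.31)] -/
theorem thm2Printed_of_nearMarginConst_cont {C : B12.Construction} (hgen : ForwardGenerated C β) {L : ℝ} (hL : 1 < L)
    (S : B12Beta.OneLoopSplit β) {a : ℕ → ℝ} {γ₀ binf c₀ θ e r m : ℝ} {k₁ : ℕ} (hγ₀ : 0 < γ₀) (hθ0 : 0 ≤ θ)
    (hθ1 : θ ≤ 1) (hconv : GeomRate a binf c₀ θ) (hnear : NearRate a S.β0 e θ) (hlist : ∀ k, k ≤ k₁ → m ≤ a k)
    (hrem : RemainderConst S γ₀ r) (hr : r < m - e - (c₀ + e) * θ ^ k₁ * (1 + θ)) (hcont : BetaContH γ₀ β) :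
    B12.Thm2Printed C L :=
  thm2Printed_of_nearMarginConst hgen hL S hγ₀ hθ0 hθ1 hconv hnear hlist hrem hr hcont
    (betaUpperH_of_geomRate_const S hθ0 hθ1 (hnear.geomRate hconv) hrem)

/-- **Theorem 2 as printed with a CERTIFIED DISCREPANCY LIST at the certified depths, (U) DERIVED** — §9's
`thm2Printed_of_depthMarginConst` without `hup`. [cite: Balaban1987RG1, Thm 2 p.259 with (0.31)] -/
theorem thm2Printed_of_depthMarginConst_cont {C : B12.Construction} (hgen : ForwardGenerated C β) {L : ℝ}
    (hL : 1 < L) (S : B12Beta.OneLoopSplit β) {a : ℕ → ℝ} {γ₀ binf c₀ θ e r m : ℝ} {k₁ : ℕ} (hγ₀ : 0 < γ₀)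
    (hθ0 : 0 ≤ θ) (hθ1 : θ ≤ 1) (hconv : GeomRate S.β0 binf c₀ θ) (hdisc : ∀ k, k ≤ k₁ → a k - e ≤ S.β0 k)
    (hlist : ∀ k, k ≤ k₁ → m ≤ a k) (hrem : RemainderConst S γ₀ r) (hr : r < m - e - c₀ * θ ^ k₁ * (1 + θ))
    (hcont : BetaContH γ₀ β) : B12.Thm2Printed C L :=
  thm2Printed_of_depthMarginConst hgen hL S hγ₀ hθ0 hθ1 hconv hdisc hlist hrem hr hcont
    (betaUpperH_of_geomRate_const S hθ0 hθ1 hconv hrem)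

/-- **Theorem 2 as printed at block size `L' = Lⁿ` via NEARNESS to the block sums, (U) DERIVED** —
`thm2Printed_of_blockNearMarginConst` without `hup`. [cite: Balaban1987RG1, Thm 2 p.259 with (0.31)] -/
theorem thm2Printed_of_blockNearMarginConst_cont {C : B12.Construction} (hgen : ForwardGenerated C β) {L' : ℝ}
    (hL : 1 < L') (S : B12Beta.OneLoopSplit β) {b : ℕ → ℝ} {n : ℕ} (hn : 0 < n) {γ₀ a θ e r m : ℝ} {k₁ : ℕ}
    (hγ₀ : 0 < γ₀) (hθ0 : 0 ≤ θ) (hθ1 : θ < 1) (hrate : CauchyRate b a θ)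
    (hnear : NearRate (blockSum n b) S.β0 e (θ ^ n)) (hlist : ∀ k, k ≤ k₁ → m ≤ blockSum n b k)
    (hrem : RemainderConst S γ₀ r)
    (hr : r < m - e - (a * (∑ i ∈ Finset.range n, θ ^ i) ^ 2 / (1 - θ ^ n) + e) * (θ ^ n) ^ k₁ * (1 + θ ^ n))
    (hcont : BetaContH γ₀ β) : B12.Thm2Printed C L' :=
  have hθn1 : θ ^ n < 1 := pow_lt_one₀ hθ0 hθ1 hn.ne'
  thm2Printed_of_nearMarginConst_cont hgen hL S hγ₀ (pow_nonneg hθ0 n) hθn1.le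
    ((cauchyRate_blockSum hrate n).geomRate hθn1) hnear hlist hrem hr hcont

/-- **END at block size via nearness, (U) DERIVED** — `endpointExistence_of_blockNearMarginConst` without `hup`.
[cite: Balaban1987RG1, Thm 2 p.259 (first sentence)] -/
theorem endpointExistence_of_blockNearMarginConst_cont {C : B12.Construction} (hgen : ForwardGenerated C β)
    (S : B12Beta.OneLoopSplit β) {b : ℕ → ℝ} {n : ℕ} (hn : 0 < n) {γ₀ a θ e r m : ℝ} {k₁ : ℕ} (hγ₀ : 0 < γ₀)
    (hθ0 : 0 ≤ θ) (hθ1 : θ < 1) (hrate : CauchyRate b a θ) (hnear : NearRate (blockSum n b) S.β0 e (θ ^ n))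
    (hlist : ∀ k, k ≤ k₁ → m ≤ blockSum n b k) (hrem : RemainderConst S γ₀ r)
    (hr : r < m - e - (a * (∑ i ∈ Finset.range n, θ ^ i) ^ 2 / (1 - θ ^ n) + e) * (θ ^ n) ^ k₁ * (1 + θ ^ n))
    (hcont : BetaContH γ₀ β) : EndpointExistence C :=
  have hθn1 : θ ^ n < 1 := pow_lt_one₀ hθ0 hθ1 hn.ne'
  endpointExistence_of_nearMarginConst_cont hgen S hγ₀ (pow_nonneg hθ0 n) hθn1.le
    ((cauchyRate_blockSum hrate n).geomRate hθn1) hnear hlist hrem hr hcont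

/-- **Theorem 2 as printed from the three lanes on the near road, window chain, (U) DERIVED** —
`thm2Printed_of_nearMarginChainL` without `hup`. [cite: Balaban1987RG1, Thm 2 p.259 with (0.31); Balaban1988RG2Cluster, (2.38) p.20 and p.21] -/
theorem thm2Printed_of_nearMarginChainL_cont {C : B12.Construction} (hgen : ForwardGenerated C β) {L : ℝ} (hL : 1 < L)
    (S : B12Beta.OneLoopSplit β) {M : ℕ} {μ ν : Fin d} {γ₀ : ℝ} {c : B13.Consts} {ℓ α₂ B₃ : ℝ}
    (R : ChainL d M μ ν S γ₀ c ℓ α₂ B₃) (hC : CondsL d c ℓ) (h22 : c.R22gen ℓ) (hs : SignsL c α₂ B₃) (hd : 0 < d)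
    (hM : 0 < M) {a : ℕ → ℝ} {binf c₀ θ e m : ℝ} {k₁ : ℕ} (hγ₀ : 0 < γ₀) (hθ0 : 0 ≤ θ) (hθ1 : θ ≤ 1)
    (hconv : GeomRate a binf c₀ θ) (hnear : NearRate a S.β0 e θ) (hlist : ∀ k, k ≤ k₁ → m ≤ a k)
    (hε₁ : c.ε₁ * remCoeffL d M c α₂ B₃ < m - e - (c₀ + e) * θ ^ k₁ * (1 + θ)) (hcont : BetaContH γ₀ β) :
    B12.Thm2Printed C L :=
  thm2Printed_of_nearMarginConst_cont hgen hL S hγ₀ hθ0 hθ1 hconv hnear hlist (R.abs_beta1_le hC h22 hs hd hM) hε₁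
    hcont

/-! ## 8. The cumulative-defect road (§10) without `hup`, `hβ'` — an4's `_cont` sockets BY NAME at END grade -/

/-- **END from the rate of a comparison sequence, ONE certified value, a cumulative defect and the constant remainder,
(U) DERIVED** — §10's `endpointExistence_of_cumNearConst` without `hβ'`, `hup`:
`DriftRemainder.endpointExistence_of_drift_remainderConst_cont` on the drift `oneLoopDrift_of_cumNear`.
[cite: Balaban1987RG1, Thm 2 p.259 (first sentence)] -/
theorem endpointExistence_of_cumNearConst_cont {C : B12.Construction} (hgen : ForwardGenerated C β)
    (S : B12Beta.OneLoopSplit β) {a : ℕ → ℝ} {γ₀ binf c₀ θ Γ r m : ℝ} {k₁ : ℕ} (hγ₀ : 0 < γ₀) (hθ0 : 0 ≤ θ)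
    (hθ1 : θ < 1) (hconv : GeomRate a binf c₀ θ) (hcert : m ≤ a k₁) (hcum : CumNear a S.β0 Γ)
    (hrem : RemainderConst S γ₀ r) (hr : r ≤ m - c₀ * θ ^ k₁) (hcont : BetaContH γ₀ β) : EndpointExistence C :=
  DriftRemainder.endpointExistence_of_drift_remainderConst_cont hgen S hγ₀ (oneLoopDrift_of_cumNear S hθ0 hθ1 hconv hcum)
    hrem (hr.trans (hconv.binf_ge hcert)) hcont

/-- **The «unconditional» p. 355 reading on the cumulative-defect road, (U) DERIVED** — §10's
`p355Unconditional_of_cumNearConst` without `hβup`, `hup`: the `World`'s upper bookkeeping constant `w.βup` is met by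
the CERTIFIABLE numeric side condition `M_c + c₀θ^{k₁} + 2(c₀/(1 − θ) + Γ) + r ≤ w.βup` from ONE certified UPPER value
`a_{k₁+1} ≤ M_c` of the comparison sequence (`GeomRate.binf_le`; `β⁰_∞` never identified) —
`DriftRemainder.p355Unconditional_of_drift_remainderConst_cont`.  HONEST FRAMING: «unconditional» in [III] p. 355's
interval-hypothesis sense only, `hnodes` kept, two chain leaves existential (Gloss 1); NOT the continuum limit, NOT
Clay. [cite: Balaban1989LargeFieldII, p.355] -/
theorem p355Unconditional_of_cumNearConst_cont (w : World) (hγw : 0 < w.γ) {γ₀ : ℝ} (hγ₀ : w.γ ≤ γ₀)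
    (hnodes : ∀ P, Nodes (leaves w P)) {βw : HBeta} (hgen : ForwardGenerated w.C.toB12 βw)
    (hhalt : HaltsOutside w.C.toB12 βw) (hcur : CurriesHBeta w.C.toB12 βw) (hcont : BetaContH γ₀ βw)
    (S : B12Beta.OneLoopSplit βw) {a : ℕ → ℝ} {binf c₀ θ Γ r mc Mc : ℝ} {k₁ : ℕ} (hθ0 : 0 ≤ θ) (hθ1 : θ < 1)
    (hconv : GeomRate a binf c₀ θ) (hcert : mc ≤ a k₁) (hcertU : a k₁ ≤ Mc) (hcum : CumNear a S.β0 Γ)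
    (hrem : RemainderConst S γ₀ r) (hr : r ≤ mc - c₀ * θ ^ k₁)
    (hwup : Mc + c₀ * θ ^ k₁ + 2 * (c₀ / (1 - θ) + Γ) + r ≤ w.βup)
    (hMγ : 2 * (c₀ / (1 - θ) + Γ) * w.γ ^ 2 ≤ w.β₀ * (2 + w.β₀)) :
    B16.Sect2Unconditional w.C ∧
      ∃ Em Ep : ℝ, ∀ m : ℕ, ∃ gstar : ℝ, 0 < gstar ∧ ∀ g : ℝ, 0 < g → g ≤ gstar →
        ∀ K : ℕ, ∃ g0 : ℝ, (w.C ⟨K, m, g0⟩).flow.g K = g ∧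
          ∀ k, k ≤ K → ∀ V : (w.C ⟨K, m, g0⟩).Cfg k, B16.UVIneq (w.C ⟨K, m, g0⟩) k V Em Ep :=
  DriftRemainder.p355Unconditional_of_drift_remainderConst_cont w hγw hγ₀ hnodes hgen hhalt hcur hcont S
    (oneLoopDrift_of_cumNear S hθ0 hθ1 hconv hcum) hrem (hr.trans (hconv.binf_ge hcert))
    (by have := hconv.binf_le hcertU; linarith) hMγ

/-- **END at block size `L' = Lⁿ` from a CUMULATIVE scheme defect, (U) DERIVED** —
`endpointExistence_of_blockCumNearConst` without `hβ'`, `hup`. [cite: Balaban1987RG1, Thm 2 p.259 (first sentence)] -/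
theorem endpointExistence_of_blockCumNearConst_cont {C : B12.Construction} (hgen : ForwardGenerated C β)
    (S : B12Beta.OneLoopSplit β) {b : ℕ → ℝ} {n : ℕ} (hn : 0 < n) {γ₀ c θ Γ r m : ℝ} {k₁ : ℕ} (hγ₀ : 0 < γ₀)
    (hθ0 : 0 ≤ θ) (hθ1 : θ < 1) (hrate : CauchyRate b c θ) (hcert : m ≤ blockSum n b k₁)
    (hcum : CumNear (blockSum n b) S.β0 Γ) (hrem : RemainderConst S γ₀ r)
    (hr : r ≤ m - c * (∑ i ∈ Finset.range n, θ ^ i) ^ 2 / (1 - θ ^ n) * (θ ^ n) ^ k₁) (hcont : BetaContH γ₀ β) :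
    EndpointExistence C :=
  have hθn1 : θ ^ n < 1 := pow_lt_one₀ hθ0 hθ1 hn.ne'
  endpointExistence_of_cumNearConst_cont hgen S hγ₀ (pow_nonneg hθ0 n) hθn1
    ((cauchyRate_blockSum hrate n).geomRate hθn1) hcert hcum hrem hr hcont

/-- **END at block size from the L-TRANSFER BOUND in the (R19) conclusion shape, (U) DERIVED** —
`endpointExistence_of_lTransferConst` without `hβ'`, `hup`: small-block Cauchy rate, ONE certified block-sum value,
the partial-sums transfer bound `hLT` (the shape of RULING (R19-1)'s conclusion, as a binder), the constant remainder,
`r ≤ m − (block rate slack)`, (C), the DAG — nothing else. [cite: Balaban1987RG1, Thm 2 p.259 (first sentence)] -/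
theorem endpointExistence_of_lTransferConst_cont {C : B12.Construction} (hgen : ForwardGenerated C β)
    (S : B12Beta.OneLoopSplit β) {b : ℕ → ℝ} {n : ℕ} (hn : 0 < n) {γ₀ c θ U r m : ℝ} {k₁ : ℕ} (hγ₀ : 0 < γ₀)
    (hθ0 : 0 ≤ θ) (hθ1 : θ < 1) (hrate : CauchyRate b c θ) (hcert : m ≤ blockSum n b k₁)
    (hLT : ∀ m' : ℕ, 1 ≤ m' → |∑ j ∈ Finset.range (n * m'), b j - ∑ j ∈ Finset.range m', S.β0 j| ≤ U)
    (hrem : RemainderConst S γ₀ r)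
    (hr : r ≤ m - c * (∑ i ∈ Finset.range n, θ ^ i) ^ 2 / (1 - θ ^ n) * (θ ^ n) ^ k₁) (hcont : BetaContH γ₀ β) :
    EndpointExistence C :=
  endpointExistence_of_blockCumNearConst_cont hgen S hn hγ₀ hθ0 hθ1 hrate hcert (cumNear_blockSum_of_flowSums hLT) hrem
    hr hcont

/-- **END from the three lanes on the cumulative-defect road, window chain, (U) DERIVED** —
`endpointExistence_of_cumNearChainL` without `hβ'`, `hup`. [cite: Balaban1987RG1, Thm 2 p.259 (first sentence); Balaban1988RG2Cluster, (2.38) p.20 and p.21] -/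
theorem endpointExistence_of_cumNearChainL_cont {C : B12.Construction} (hgen : ForwardGenerated C β)
    (S : B12Beta.OneLoopSplit β) {M : ℕ} {μ ν : Fin d} {γ₀ : ℝ} {c : B13.Consts} {ℓ α₂ B₃ : ℝ}
    (R : ChainL d M μ ν S γ₀ c ℓ α₂ B₃) (hC : CondsL d c ℓ) (h22 : c.R22gen ℓ) (hs : SignsL c α₂ B₃) (hd : 0 < d)
    (hM : 0 < M) {a : ℕ → ℝ} {binf c₀ θ Γ m : ℝ} {k₁ : ℕ} (hγ₀ : 0 < γ₀) (hθ0 : 0 ≤ θ) (hθ1 : θ < 1)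
    (hconv : GeomRate a binf c₀ θ) (hcert : m ≤ a k₁) (hcum : CumNear a S.β0 Γ)
    (hε₁ : c.ε₁ * remCoeffL d M c α₂ B₃ ≤ m - c₀ * θ ^ k₁) (hcont : BetaContH γ₀ β) : EndpointExistence C :=
  endpointExistence_of_cumNearConst_cont hgen S hγ₀ hθ0 hθ1 hconv hcert hcum (R.abs_beta1_le hC h22 hs hd hM) hε₁ hcont

/-- **Theorem 2 as printed on the cumulative-defect road, (U) DERIVED** — §10's `thm2Printed_of_cumNearMarginConst`
without `hup`: the ceiling of `S.β0` is `β⁰_∞ + c₀ + 2Γ` (`ceiling_of_geomRate` for the comparison sequence,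
`CumNear.abs_sub_le` for the pointwise defect), so the upper constant is `β⁰_∞ + c₀ + 2Γ + r`.
[cite: Balaban1987RG1, Thm 2 p.259 with (0.31)] -/
theorem thm2Printed_of_cumNearMarginConst_cont {C : B12.Construction} (hgen : ForwardGenerated C β) {L : ℝ}
    (hL : 1 < L) (S : B12Beta.OneLoopSplit β) {a : ℕ → ℝ} {γ₀ binf c₀ θ Γ r m : ℝ} {k₁ : ℕ} (hγ₀ : 0 < γ₀)
    (hθ0 : 0 ≤ θ) (hθ1 : θ ≤ 1) (hconv : GeomRate a binf c₀ θ) (hlist : ∀ k, k ≤ k₁ → m ≤ a k)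
    (hcum : CumNear a S.β0 Γ) (hrem : RemainderConst S γ₀ r) (hr : r < m - c₀ * θ ^ k₁ * (1 + θ) - 2 * Γ)
    (hcont : BetaContH γ₀ β) : B12.Thm2Printed C L :=
  thm2Printed_of_cumNearMarginConst hgen hL S hγ₀ hθ0 hθ1 hconv hlist hcum hrem hr hcont
    (betaUpperH_of_ceiling_const S (g := binf + c₀ + 2 * Γ)
      (fun k => by linarith [ceiling_of_geomRate hconv hθ0 hθ1 k, (abs_le.mp (hcum.abs_sub_le k)).2]) hrem)

/-! ## 9. The eventual road (§11) without `hup` — no certified upper value needed -/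

/-- **END from an EVENTUAL rate and a certified list, (U) DERIVED** — §11's `endpointExistence_of_evMarginConst`
without `hup`: the band `∃ G, ∀ k, |β⁰_{k+1}| ≤ G` is `exists_abs_le_of_evGeomRate` (tail from the rate, the finitely
many pre-threshold values bound themselves). [cite: Balaban1987RG1, Thm 2 p.259 (first sentence)] -/
theorem endpointExistence_of_evMarginConst_cont {C : B12.Construction} (hgen : ForwardGenerated C β)
    (S : B12Beta.OneLoopSplit β) {γ₀ binf c₀ θ r m : ℝ} {k₁ : ℕ} (hγ₀ : 0 < γ₀) (hθ0 : 0 ≤ θ) (hθ1 : θ ≤ 1)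
    (hconv : EvGeomRate S.β0 binf c₀ θ k₁) (hlist : ∀ k, k ≤ k₁ → m ≤ S.β0 k) (hrem : RemainderConst S γ₀ r)
    (hr : r < m - c₀ * θ ^ k₁ * (1 + θ)) (hcont : BetaContH γ₀ β) : EndpointExistence C := by
  obtain ⟨G, hG⟩ := exists_abs_le_of_evGeomRate hconv hθ0 hθ1
  exact endpointExistence_of_evMarginConst hgen S hγ₀ hθ0 hθ1 hconv hlist hrem hr (betaUpperH_of_band_const S hG hrem)
    hcont

/-- **Theorem 2 as printed from an EVENTUAL rate and a certified list, (U) DERIVED** — §11's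
`thm2Printed_of_evMarginConst` without `hup`. [cite: Balaban1987RG1, Thm 2 p.259 with (0.31)] -/
theorem thm2Printed_of_evMarginConst_cont {C : B12.Construction} (hgen : ForwardGenerated C β) {L : ℝ} (hL : 1 < L)
    (S : B12Beta.OneLoopSplit β) {γ₀ binf c₀ θ r m : ℝ} {k₁ : ℕ} (hγ₀ : 0 < γ₀) (hθ0 : 0 ≤ θ) (hθ1 : θ ≤ 1)
    (hconv : EvGeomRate S.β0 binf c₀ θ k₁) (hlist : ∀ k, k ≤ k₁ → m ≤ S.β0 k) (hrem : RemainderConst S γ₀ r)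
    (hr : r < m - c₀ * θ ^ k₁ * (1 + θ)) (hcont : BetaContH γ₀ β) : B12.Thm2Printed C L := by
  obtain ⟨G, hG⟩ := exists_abs_le_of_evGeomRate hconv hθ0 hθ1
  exact thm2Printed_of_evMarginConst hgen hL S hγ₀ hθ0 hθ1 hconv hlist hrem hr hcont
    (betaUpperH_of_band_const S hG hrem)

/-- Cauchy form of the preceding (`hθ1 : θ < 1`, `EvCauchyRate.evGeomRate`), without `hup`.
[cite: Balaban1987RG1, Thm 2 p.259 with (0.31)] -/
theorem thm2Printed_of_evCauchyMarginConst_cont {C : B12.Construction} (hgen : ForwardGenerated C β) {L : ℝ}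
    (hL : 1 < L) (S : B12Beta.OneLoopSplit β) {γ₀ c θ r m : ℝ} {k₁ : ℕ} (hγ₀ : 0 < γ₀) (hθ0 : 0 ≤ θ)
    (hθ1 : θ < 1) (hrate : EvCauchyRate S.β0 c θ k₁) (hlist : ∀ k, k ≤ k₁ → m ≤ S.β0 k)
    (hrem : RemainderConst S γ₀ r) (hr : r < m - c / (1 - θ) * θ ^ k₁ * (1 + θ)) (hcont : BetaContH γ₀ β) :
    B12.Thm2Printed C L :=
  thm2Printed_of_evMarginConst_cont hgen hL S hγ₀ hθ0 hθ1.le (hrate.evGeomRate hθ1) hlist hrem hr hcont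

/-- **Theorem 2 as printed from the three lanes with an EVENTUAL rate, window chain, (U) DERIVED** —
`thm2Printed_of_evMarginChainL` without `hup`. [cite: Balaban1987RG1, Thm 2 p.259 with (0.31); Balaban1988RG2Cluster, (2.38) p.20 and p.21] -/
theorem thm2Printed_of_evMarginChainL_cont {C : B12.Construction} (hgen : ForwardGenerated C β) {L : ℝ} (hL : 1 < L)
    (S : B12Beta.OneLoopSplit β) {M : ℕ} {μ ν : Fin d} {γ₀ : ℝ} {c : B13.Consts} {ℓ α₂ B₃ : ℝ}
    (R : ChainL d M μ ν S γ₀ c ℓ α₂ B₃) (hC : CondsL d c ℓ) (h22 : c.R22gen ℓ) (hs : SignsL c α₂ B₃) (hd : 0 < d)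
    (hM : 0 < M) {binf c₀ θ m : ℝ} {k₁ : ℕ} (hγ₀ : 0 < γ₀) (hθ0 : 0 ≤ θ) (hθ1 : θ ≤ 1)
    (hconv : EvGeomRate S.β0 binf c₀ θ k₁) (hlist : ∀ k, k ≤ k₁ → m ≤ S.β0 k)
    (hε₁ : c.ε₁ * remCoeffL d M c α₂ B₃ < m - c₀ * θ ^ k₁ * (1 + θ)) (hcont : BetaContH γ₀ β) :
    B12.Thm2Printed C L :=
  thm2Printed_of_evMarginConst_cont hgen hL S hγ₀ hθ0 hθ1 hconv hlist (R.abs_beta1_le hC h22 hs hd hM) hε₁ hcont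

/-- **END from the three lanes with an EVENTUAL rate, window chain, (U) DERIVED** —
`endpointExistence_of_evMarginChainL` without `hup`. [cite: Balaban1987RG1, Thm 2 p.259 (first sentence); Balaban1988RG2Cluster, (2.38) p.20 and p.21] -/
theorem endpointExistence_of_evMarginChainL_cont {C : B12.Construction} (hgen : ForwardGenerated C β)
    (S : B12Beta.OneLoopSplit β) {M : ℕ} {μ ν : Fin d} {γ₀ : ℝ} {c : B13.Consts} {ℓ α₂ B₃ : ℝ}
    (R : ChainL d M μ ν S γ₀ c ℓ α₂ B₃) (hC : CondsL d c ℓ) (h22 : c.R22gen ℓ) (hs : SignsL c α₂ B₃) (hd : 0 < d)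
    (hM : 0 < M) {binf c₀ θ m : ℝ} {k₁ : ℕ} (hγ₀ : 0 < γ₀) (hθ0 : 0 ≤ θ) (hθ1 : θ ≤ 1)
    (hconv : EvGeomRate S.β0 binf c₀ θ k₁) (hlist : ∀ k, k ≤ k₁ → m ≤ S.β0 k)
    (hε₁ : c.ε₁ * remCoeffL d M c α₂ B₃ < m - c₀ * θ ^ k₁ * (1 + θ)) (hcont : BetaContH γ₀ β) :
    EndpointExistence C :=
  endpointExistence_of_evMarginConst_cont hgen S hγ₀ hθ0 hθ1 hconv hlist (R.abs_beta1_le hC h22 hs hd hM) hε₁ hcont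

/-! ## 10. Kernel checks on the witnesses: the assumed upper bounds of v1.1 ∕ v1.3 are the derived ones -/

/-- On RCC §7's scale-dependent witness (`β⁰_{k+1} = 1 + (1/2)^k`, `β¹ ≡ 0`, rate `GeomRate β⁰ 1 1 (1/2)`, `r = 0`)
the DERIVED upper constant `β⁰_∞ + c₀ + r = 1 + 1 + 0` gives back the upper bound
`RemainderConstCertified.Witness.betaUpperH_geomFamily : BetaUpperH 2 1 geomFamily` that RCC v1.1 had to ASSUME.
[folklore] -/
theorem Witness.betaUpperH_geomFamily_derived : BetaUpperH (1 + 1 + 0) 1 Witness.geomFamily :=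
  betaUpperH_of_geomRate_const Witness.splitGeom (by norm_num) (by norm_num) Witness.geomRate_splitGeom
    Witness.remainderConst_splitGeom

example : BetaUpperH 2 1 Witness.geomFamily := by
  rw [show (2 : ℝ) = 1 + 1 + 0 by norm_num]
  exact Witness.betaUpperH_geomFamily_derived

/-- RCC §11's eventual witness data (`β⁰_1 = 2`, `β⁰_{k+1} = 1` for `k ≥ 1`; `EvGeomRate β⁰ 1 0 0 1`, NO `GeomRate`)
still yield a uniform band with NO upper-bound input (`exists_abs_le_of_evGeomRate`). [folklore] -/
example : ∃ G : ℝ, ∀ k, |(fun k : ℕ => if k = 0 then (2 : ℝ) else 1) k| ≤ G :=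
  exists_abs_le_of_evGeomRate (binf := 1) (c₀ := 0) (θ := 0) (k₁ := 1)
    (fun k hk => by
      have hk0 : k ≠ 0 := by omega
      show |(if k = 0 then (2 : ℝ) else 1) - 1| ≤ 0 * 0 ^ k
      simp [hk0])
    le_rfl zero_le_one

/-! ## 11. (v1.1) The six remaining two-sided-road twins (independent read GAPS C-pv09g9-5, INFO I2)

v1's §0 sentence «every END ∕ Theorem-2-printed theorem of §§4–11 has a twin WITHOUT `hup`» was true as mathematics and
inexact as an INVENTORY: six two-sided-road theorems of RCC carrying `hup` had no spelled-out `_cont` twin and were not in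
the «not spelled out» enumeration (the cell's independent read, record GAPS C-pv09g9-5 INFO I2, names them by RCC line).
They are spelled out here.  Binders = those of the RCC theorem minus `hup` (in (a) also minus the lower companion
`hlo : −β' ≤ β_{k+1}`), same order; the implicit `β'` disappears, and where the conclusion displays the upper constant it
is the DERIVED one:
(a) `thm2_fineLattices_of_certifiedConst_cont` — RCC §4 `thm2_fineLattices_of_certifiedConst` (the threshold form of
(0.31) on the fine lattices) with the BAND constant `β' = |β⁰_∞| + c₀ + r` (`abs_le_of_geomRate`; the band and not the
ceiling because the same `β'` serves the lower companion `−β' ≤ β_{k+1}` of `Assembly.EventualForm`, exactly as in §4's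
`endpointExistence_of_certifiedConst_cont`);
(b) `thm2Printed_of_certified_const_cont` — RCC §4's drop-in twin of asym1's `RateCertificate.thm2Printed_of_certified`
(ONE certified ENCLOSURE `m ≤ β⁰_{k₁+1} ≤ M`; its binder named `hlo` is that lower certified value and stays);
(c) `thm2Printed_of_blockMarginChainL_cont` — RCC §8, block road × window chain at the large block size `L'`;
(d) `thm2_fineLattices_of_nearMarginConst_cont` — RCC §9, (0.31) with NO threshold on the near road, upper constant
`β⁰_∞ + (c₀ + e) + r` (`NearRate.geomRate`: the rate constant of `S.β0` is `c₀ + e`);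
(e) `thm2Printed_of_blockMarginConst'_cont` — RCC §9's consistency re-derivation of the block road as the case `e = 0`
of the near road;
(f) `thm2Printed_of_blockNearMarginChainL_cont` — RCC §9, block nearness × window chain at `L'`.
Each proof is the one-term composition already used in §§4–9.

NOT twinned, BY DESIGN — the exact inventory of the RCC declarations that carry `hup` and have no `_cont` form in this
file: (i) the bare FLOOR road — RCC §3 `eventualFormOfFloorConst`, `eventualFormOfFloorConst_consts`,
`thm2Printed_of_floor_const` and RCC §11 `endpointExistence_of_floor_const`: a one-sided floor gives no ceiling, so `hup`
is a genuine input there (§3 of this file offers the floor-AND-ceiling sockets instead); (ii) the `def` CARRIERS and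
their constant read-outs — RCC §4 `eventualFormOfCertifiedConst`, `eventualFormOfCertifiedConst_consts`, RCC §7
`eventualFormOfMarginConst`, `eventualFormOfMarginConst_consts`: instantiate `β'`, `hup`, `hlo` with `|β⁰_∞| + c₀ + r`,
`betaUpperH_of_band_const`, `betaNegLower_of_band_const` (a `_cont` carrier would be one more `def` with no consumer);
(iii) the one-term SPECIALISATIONS of theorems twinned in §§4–9 — RCC §4 `thm2Printed_of_smallKCertConst`; RCC §5
`thm2Printed_of_certifiedChainT`, `endpointExistence_of_certifiedChainT`, `thm2Printed_of_certifiedChainL_elem`; RCC §7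
`thm2Printed_of_symbolMarginConst`, `thm2Printed_of_stripMarginConst`, `thm2Printed_of_marginChainT`,
`thm2Printed_of_marginChainL_elem`, `endpointExistence_of_marginChainT`; RCC §8 `thm2Printed_of_realMarginConst`,
`thm2Printed_of_realMarginConst_decay`: each is a twinned parent (`thm2Printed_of_certifiedConst`,
`endpointExistence_of_certifiedConst`, `thm2Printed_of_marginConst`, `thm2Printed_of_cauchyMarginConst`,
`endpointExistence_of_marginConst`) at particular arguments, so its `_cont` form is that parent's `_cont` at the same
arguments.  Count: of the 55 RCC declarations whose statement carries `hup`, 30 are twinned in §§4–9, 6 here, and the 19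
of (i)–(iii) are not — with (a)–(f) the sentence of §0 is exact as an inventory.  Nothing of the series is discharged;
the STILL-OPEN list of the header is unchanged; NOT Theorem 2 unconditionally, NOT the continuum limit, NOT the Clay
problem. -/

/-- **(0.31) on the FINE lattices with a threshold, certified road, (U) DERIVED** — RCC §4's
`thm2_fineLattices_of_certifiedConst` without `hup`, `hlo`: the two-sided bound `|β_{k+1}| ≤ |β⁰_∞| + c₀ + r` is DERIVED
from `hconv` and `hrem` (`abs_le_of_geomRate`, `betaUpperH_of_band_const`, `betaNegLower_of_band_const`), and the upper
constant of `Step.Discrete031` and of the two provisos is that band constant. [cite: Balaban1987RG1, Thm 2 (0.31) p.259] -/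
theorem thm2_fineLattices_of_certifiedConst_cont {C : B12.Construction} (hgen : ForwardGenerated C β)
    (S : B12Beta.OneLoopSplit β) {γ₀ binf c₀ θ r m : ℝ} {k₁ k₂ : ℕ} (hγ₀ : 0 < γ₀) (hθ0 : 0 ≤ θ) (hθ1 : θ ≤ 1)
    (hconv : GeomRate S.β0 binf c₀ θ) (hcert : m ≤ S.β0 k₁) (hk₂ : c₀ * θ ^ k₂ ≤ (m - c₀ * θ ^ k₁) / 4)
    (hrem : RemainderConst S γ₀ r) (hr : r < 3 * (m - c₀ * θ ^ k₁) / 4) (hcont : BetaContH γ₀ β) :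
    ∀ (n : ℕ) (γ : ℝ), 0 < γ → γ ≤ γ₀ → ∀ g : ℝ, 0 < g → 1 / γ ^ 2 + (|binf| + c₀ + r) * k₂ ≤ 1 / g ^ 2 →
      ∀ K : ℕ, (3 * (3 * (m - c₀ * θ ^ k₁) / 4 - r) + 2 * (|binf| + c₀ + r)) * k₂ ≤ (3 * (m - c₀ * θ ^ k₁) / 4 - r) * K →
        ∃ g0 : ℝ, (C ⟨K, n, g0⟩).flow.InInterval γ K ∧ (C ⟨K, n, g0⟩).flow.g K = g ∧
          Step.Discrete031 ((3 * (m - c₀ * θ ^ k₁) / 4 - r) / 2) (|binf| + c₀ + r) K g (C ⟨K, n, g0⟩).flow.g :=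
  thm2_fineLattices_of_certifiedConst hgen S hγ₀ hθ0 hθ1 hconv hcert hk₂ hrem hr
    (betaUpperH_of_band_const S (abs_le_of_geomRate hconv hθ0 hθ1) hrem)
    (betaNegLower_of_band_const S (abs_le_of_geomRate hconv hθ0 hθ1) hrem) hcont

/-- **THEOREM 2 AS PRINTED from ONE certified ENCLOSURE, (U) DERIVED** — RCC §4's `thm2Printed_of_certified_const` (the
drop-in twin of asym1's `RateCertificate.thm2Printed_of_certified`: `m ≤ β⁰_{k₁+1} ≤ M`, the index `k₂`, the list
`3(M + c₀θ^{k₁})/4 ≤ β⁰_{k+1}` for `k < k₂`, the constant remainder with `r < 3(m − c₀θ^{k₁})/4`, (C)) without `hup`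
(upper constant `β⁰_∞ + c₀ + r`, `betaUpperH_of_geomRate_const`). [cite: Balaban1987RG1, Thm 2 p.259 with (0.31)] -/
theorem thm2Printed_of_certified_const_cont {C : B12.Construction} (hgen : ForwardGenerated C β) {L : ℝ} (hL : 1 < L)
    (S : B12Beta.OneLoopSplit β) {γ₀ binf c₀ θ r m M : ℝ} {k₁ k₂ : ℕ} (hγ₀ : 0 < γ₀) (hθ0 : 0 ≤ θ)
    (hθ1 : θ < 1) (hconv : GeomRate S.β0 binf c₀ θ) (hlo : m ≤ S.β0 k₁) (hhi : S.β0 k₁ ≤ M)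
    (hk₂ : c₀ * θ ^ k₂ ≤ (m - c₀ * θ ^ k₁) / 4) (hsmall : ∀ k, k < k₂ → 3 * (M + c₀ * θ ^ k₁) / 4 ≤ S.β0 k)
    (hrem : RemainderConst S γ₀ r) (hr : r < 3 * (m - c₀ * θ ^ k₁) / 4) (hcont : BetaContH γ₀ β) :
    B12.Thm2Printed C L :=
  thm2Printed_of_certified_const hgen hL S hγ₀ hθ0 hθ1 hconv hlo hhi hk₂ hsmall hrem hr hcont
    (betaUpperH_of_geomRate_const S hθ0 hθ1.le hconv hrem)

/-- **THEOREM 2 AS PRINTED AT THE LARGE BLOCK SIZE, window chain at `L'`, (U) DERIVED** — RCC §8's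
`thm2Printed_of_blockMarginChainL` without `hup`: the remainder slot of §6's `thm2Printed_of_blockMarginConst_cont` filled
by `R : ChainL d M μ ν S γ₀ c ℓ α₂ B₃` (printed leaves BY NAME as fields, (D4)) under `CondsL`, `R22gen ℓ`, the printed
signs, and the ONE condition `ε₁·K_rem,L' < m − a(Σ_{i<n}θ^i)²/(1 − θⁿ)·(θⁿ)^{k₁}(1 + θⁿ)`.  NOT Theorem 2 unconditionally.
[cite: Balaban1987RG1, Thm 2 p.259 with (0.31); Balaban1988RG2Cluster, (2.38) p.20 and p.21] -/
theorem thm2Printed_of_blockMarginChainL_cont {C : B12.Construction} (hgen : ForwardGenerated C β) {L' : ℝ}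
    (hL : 1 < L') (S : B12Beta.OneLoopSplit β) {M : ℕ} {μ ν : Fin d} {γ₀ : ℝ} {c : B13.Consts} {ℓ α₂ B₃ : ℝ}
    (R : ChainL d M μ ν S γ₀ c ℓ α₂ B₃) (hC : CondsL d c ℓ) (h22 : c.R22gen ℓ) (hs : SignsL c α₂ B₃) (hd : 0 < d)
    (hM : 0 < M) {b : ℕ → ℝ} {n : ℕ} (hn : 0 < n) (hblock : ∀ k, S.β0 k = blockSum n b k) {a θ m : ℝ} {k₁ : ℕ}
    (hγ₀ : 0 < γ₀) (hθ0 : 0 ≤ θ) (hθ1 : θ < 1) (hrate : CauchyRate b a θ) (hlist : ∀ k, k ≤ k₁ → m ≤ blockSum n b k)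
    (hε₁ : c.ε₁ * remCoeffL d M c α₂ B₃ <
      m - a * (∑ i ∈ Finset.range n, θ ^ i) ^ 2 / (1 - θ ^ n) * (θ ^ n) ^ k₁ * (1 + θ ^ n))
    (hcont : BetaContH γ₀ β) : B12.Thm2Printed C L' :=
  thm2Printed_of_blockMarginConst_cont hgen hL S hn hblock hγ₀ hθ0 hθ1 hrate hlist (R.abs_beta1_le hC h22 hs hd hM) hε₁
    hcont

/-- **(0.31) on the FINE lattices, near road — WITH NO THRESHOLD, (U) DERIVED** — RCC §9's
`thm2_fineLattices_of_nearMarginConst` without `hup`: §5's `thm2_fineLattices_of_marginConst_cont` at the transported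
constants (`NearRate.geomRate`, `NearRate.list`); lower constant `b/2`, `b = m − e − (c₀ + e)θ^{k₁}(1 + θ) − r`, DERIVED
upper constant `β' = β⁰_∞ + (c₀ + e) + r`; every number of steps `K`, every `0 < g ≤ γ ≤ γ₀`.
[cite: Balaban1987RG1, Thm 2 (0.31) p.259] -/
theorem thm2_fineLattices_of_nearMarginConst_cont {C : B12.Construction} (hgen : ForwardGenerated C β)
    (S : B12Beta.OneLoopSplit β) {a : ℕ → ℝ} {γ₀ binf c₀ θ e r m : ℝ} {k₁ : ℕ} (hγ₀ : 0 < γ₀) (hθ0 : 0 ≤ θ)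
    (hθ1 : θ ≤ 1) (hconv : GeomRate a binf c₀ θ) (hnear : NearRate a S.β0 e θ) (hlist : ∀ k, k ≤ k₁ → m ≤ a k)
    (hrem : RemainderConst S γ₀ r) (hr : r < m - e - (c₀ + e) * θ ^ k₁ * (1 + θ)) (hcont : BetaContH γ₀ β) :
    ∀ (n : ℕ) (γ : ℝ), 0 < γ → γ ≤ γ₀ → ∀ g : ℝ, 0 < g → g ≤ γ → ∀ K : ℕ,
      ∃ g0 : ℝ, (C ⟨K, n, g0⟩).flow.InInterval γ K ∧ (C ⟨K, n, g0⟩).flow.g K = g ∧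
        Step.Discrete031 ((m - e - (c₀ + e) * θ ^ k₁ * (1 + θ) - r) / 2) (binf + (c₀ + e) + r) K g
          (C ⟨K, n, g0⟩).flow.g :=
  thm2_fineLattices_of_marginConst_cont hgen S hγ₀ hθ0 hθ1 (hnear.geomRate hconv) (hnear.list hθ0 hθ1 hlist) hrem hr
    hcont

/-- **The block road as the case `e = 0` of the near road, (U) DERIVED** — RCC §9's consistency re-derivation
`thm2Printed_of_blockMarginConst'` without `hup`: Theorem 2 at the large block size from the composition hypothesis
`hblock` through §7's `thm2Printed_of_blockNearMarginConst_cont` (`NearRate.of_eq`). [folklore] -/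
theorem thm2Printed_of_blockMarginConst'_cont {C : B12.Construction} (hgen : ForwardGenerated C β) {L' : ℝ}
    (hL : 1 < L') (S : B12Beta.OneLoopSplit β) {b : ℕ → ℝ} {n : ℕ} (hn : 0 < n)
    (hblock : ∀ k, S.β0 k = blockSum n b k) {γ₀ a θ r m : ℝ} {k₁ : ℕ} (hγ₀ : 0 < γ₀) (hθ0 : 0 ≤ θ) (hθ1 : θ < 1)
    (hrate : CauchyRate b a θ) (hlist : ∀ k, k ≤ k₁ → m ≤ blockSum n b k) (hrem : RemainderConst S γ₀ r)
    (hr : r < m - a * (∑ i ∈ Finset.range n, θ ^ i) ^ 2 / (1 - θ ^ n) * (θ ^ n) ^ k₁ * (1 + θ ^ n))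
    (hcont : BetaContH γ₀ β) : B12.Thm2Printed C L' :=
  thm2Printed_of_blockNearMarginConst_cont hgen hL S hn hγ₀ hθ0 hθ1 hrate (NearRate.of_eq hblock _) hlist hrem
    (by simpa using hr) hcont

/-- **THEOREM 2 AS PRINTED FOR THE GENUINE BLOCK-SIZE-`Lⁿ` STEP, window chain at `L'`, (U) DERIVED** — RCC §9's
`thm2Printed_of_blockNearMarginChainL` without `hup`: the remainder slot of §7's `thm2Printed_of_blockNearMarginConst_cont`
filled by the window chain `R` under `CondsL`, `R22gen ℓ`, the printed signs, and the ONE condition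
`ε₁·K_rem,L' < m − e − (a(Σ_{i<n}θ^i)²/(1 − θⁿ) + e)(θⁿ)^{k₁}(1 + θⁿ)`.  NOT Theorem 2 unconditionally.
[cite: Balaban1987RG1, Thm 2 p.259 with (0.31); Balaban1988RG2Cluster, (2.38) p.20 and p.21] -/
theorem thm2Printed_of_blockNearMarginChainL_cont {C : B12.Construction} (hgen : ForwardGenerated C β) {L' : ℝ}
    (hL : 1 < L') (S : B12Beta.OneLoopSplit β) {M : ℕ} {μ ν : Fin d} {γ₀ : ℝ} {c : B13.Consts} {ℓ α₂ B₃ : ℝ}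
    (R : ChainL d M μ ν S γ₀ c ℓ α₂ B₃) (hC : CondsL d c ℓ) (h22 : c.R22gen ℓ) (hs : SignsL c α₂ B₃) (hd : 0 < d)
    (hM : 0 < M) {b : ℕ → ℝ} {n : ℕ} (hn : 0 < n) {a θ e m : ℝ} {k₁ : ℕ} (hγ₀ : 0 < γ₀) (hθ0 : 0 ≤ θ)
    (hθ1 : θ < 1) (hrate : CauchyRate b a θ) (hnear : NearRate (blockSum n b) S.β0 e (θ ^ n))
    (hlist : ∀ k, k ≤ k₁ → m ≤ blockSum n b k)
    (hε₁ : c.ε₁ * remCoeffL d M c α₂ B₃ <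
      m - e - (a * (∑ i ∈ Finset.range n, θ ^ i) ^ 2 / (1 - θ ^ n) + e) * (θ ^ n) ^ k₁ * (1 + θ ^ n))
    (hcont : BetaContH γ₀ β) : B12.Thm2Printed C L' :=
  thm2Printed_of_blockNearMarginConst_cont hgen hL S hn hγ₀ hθ0 hθ1 hrate hnear hlist (R.abs_beta1_le hC h22 hs hd hM)
    hε₁ hcont

end Literature.MathematicalPhysics.QuantumFieldTheory.Balaban1983to89.Beta.RemainderConstUpperDerived
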